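import Summits.QuantumFields.BalabanUV.Beta.FP.NestedStepLawTorusTransportedRowsGradedLevelZeroSymULowClosedLam
import Summits.QuantumFields.BalabanUV.Beta.CombWilsonT2PeriodisedK2

/-!
# `BalabanUV.Beta.FP.NestedStepLawTorusTransportedRowsGradedLevelZeroSymULowClosedLamW2` — road «FP» for binder row D1, ROUTE T, presentation T-β, option (δ)
# «LIFT ∕ GRADED» (R-FP-54′), an2's (J-a) programme item (β) × (α-3)-W, LEVEL-0 STOREY, ORDER 2: **THE GRADED DOOR AT THE (III′) LITERAL, LEVEL `j = 0`, WITH THE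
# SECOND-ORDER FORM JET BOUND — `w² •` an2's PERIODISED WILSON BI-MEMBER along `h ⊗ h` `+` a FREE ADDITIVE order-2 family `G`; `k2 hH₂t` DISCHARGED BY TERM**
# = `…LevelZeroSymULowClosedLam` (U18, p337409) with `H₂ := w² • Σ_b Σ_{b′} (h b·h b′) • H₂^{b,b′} + G`, `w = −2c`, `c = (Lc^{d+1}·stepScale d Lc 0)⁻¹`,
# `H₂^{b,b′} := perF F (dper F (W b′.2 ↑b′.1 b.2 ↑b.1))∘(ff)` for the SECOND-SLOT-PERIODISED Wilson bi-family `hW : W = fun κ′ u′ κ u … => Σ'_n T₂ κ u κ′ (u′ + F∘n) …`,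
# `T₂ := wilsonW₂ d ((8N²)⁻¹ • wsym22 N)` (an3's tables; an2 g42 `CombWilsonT2Periodised` ∕ `CombWilsonT2PeriodisedK2`), and the one-shot chart's second form jet NAMED
# `H′₂ := w² • Σ_b Σ_{b′} ((h+Dλ)_b·(h+Dλ)_{b′}) • H₂^{b,b′} + w • (L·E_λ − E_λ·L) + G` (`L := Σ_b h b • (w_Λ • Λ^b)` = U18's Λ half of `H₁`, `E_λ := diagonal (λ∘pr₁)`):
# the binders `k2` (an2's `torus_k2_sim_letter` + linearity of the `k2` word in `H₂`) and `hH₂t` (an2's `torus_H2_transpose` + the displayed parity `hGt : Gᵀ = G`)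
# are REMOVED.  AFTER IT THE (J-a) (β) DOOR AT LEVEL 0 DISPLAYS ONLY: `q2 a2 c2 d2 t2` (order 2, generator∕averaging∕Ward∕covariance sides), `a1`, `hdead`, `hGt`,
# the coarse presentation `hfμ′ hcoarse′`, the weight letters `w` (Λ) and `N` (colour), namings and defining equations.  Proof = `subst` + ONE TERM.

WHAT.  U18 `NestedStepLawTorusTransportedRowsGradedLevelZeroSymULowClosedLam.secondVar_oneShot_nestedStepLaw_torus_transported_graded_rows_levelZero_sym_uLow_closed_lam`
(leaf-02 g21) is the (III′) torus call at level `j = 0` on the uLow bottom with every order-0∕1 letter a theorem BY NAME and the first-order form jet bound to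
`(−2c) •` leaf-05's periodised WILSON family `+ Σ_b h b • (w • Λ^b)` (an2's periodised Λ-sector family of record); over a FREE second-order form jet `H₂` it
displays the GRADED order-2 form word `k2 : (XX)ᵀH₀ − XᵀH₁ − XᵀH₀X − XᵀH₁ − XᵀH₀X + H₂ + H₁X + H₁X + H₀XX = H′₂` and the parity `hH₂t : H₂ᵀ = H₂`.

an2 g42's (α-3)-W FILE 2 `CombWilsonT2PeriodisedK2` supplies, for the torus bi-member of the literal's order-2 Wilson table with its SECOND slot summed over the
period copies (`hW`), at `F = fine Lc M′` and leaf-05's level-0 form block (`hH₀` at `r := ctrOff`, reached from the (III′) spelling by (β-b) §0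
`perF_bhKStepSh_Dsh_ff_eq_perF_bhKStepAt`):
* `torus_k2_sim_letter` — with the DIAGONAL generator `X := (w∕2) • E_λ` (leaf-02's pin `hX : X = −c • E_λ` ⟺ `w = −2c`), `H₁ := w • H₁^{W,(h)} + L` (`L` ANY
  additive first-order family — here U18's Λ half) and `H₂ := w² • H₂^{(h,h)}`, the door's `k2` left side EQUALS `w² • H₂^{(h+Dλ, h+Dλ)} + w • (L E_λ − E_λ L)`;
* `torus_H2_transpose` — `(Σ_b Σ_{b′} (g b·g′ b′) • H₂^{b,b′})ᵀ = Σ_b Σ_{b′} (g b·g′ b′) • H₂^{b,b′}`.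
The `k2` word is AFFINE in `H₂` with unit slope, so a FREE ADDITIVE order-2 matrix `G` rides along exactly as `Λ` rode at order 1 in U18 («rows are linear»;
OWNER W-FP-19-18: at order 2 representatives are allowed): it enters `H₂` and `H′₂` UN-SHIFTED and its parity `hGt : Gᵀ = G` is DISPLAYED.  At the literal's
level 0 the order-2 form table is `T2RecOf … 0 = Lc⁸ • T₂ + cB • symVh₂SAn1` (`RecursiveWSlot`; an2 JA-TABLE v1.5 Δ1) and the border table is ff-FREE
(`SymSecondOrderTablesAn1.symTablesAn1S2_vh₂S_inl_inl`), so under reading (a) of an2's located question Q-an2-g42-1 (→ OWNER: `H₂ :=` the partial `∂²_U`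
table) `G = 0`, and under reading (b) (`H₂ :=` the total fine second jet) `G :=` the order-2 Λ-companions once typed — either way an instance of THIS
statement.  The extra commutator `w • (L E_λ − E_λ L)` is displayed inside the NAME `H′₂`; nothing about an order-2 index law of `G` or of the Λ sector is
asserted.

This file is ONE theorem **`secondVar_oneShot_nestedStepLaw_torus_transported_graded_rows_levelZero_sym_uLow_closed_lam_w2`** = U18 with `H₂ H′₂` bound as
above (`hH₂ hH′₂`), the bi-family `W` (`hW` — an2's spelling VERBATIM), the colour letter `N` (`hN : 2 ≤ N`), the family `G` and its parity `hGt` ADDED, and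
the binders `k2 hH₂t` REMOVED.  Proof = `subst` + ONE TERM (`k2`: `torus_k2_sim_letter` at `w := −2c`, `L :=` the Λ half, then `abel` for the `G` slope;
`hH₂t`: `torus_H2_transpose` + `hGt`).  [folklore] composition BY NAME; nothing of an2's, leaf-05's, leaf-06's or the OWNER's restated; no `def`, no
`def … : Prop`, nothing cited, 0 sorry.

WHAT THIS DOES NOT SAY (the dictionary's, an2 ∕ the OWNER): whether the (III′) record's level-0 SECOND-order form table along `h ⊗ h` IS `w² •` the
periodised Wilson bi-member `+ G` and WHICH `G` (an2's JA-TABLE (β) ∕ (α-3); the weight square `w² = 4c²` is what `k2_sim_word` forces — an2's displayed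
arithmetic `cE₂ = cE²`, the literal's `Lc⁸ = (Lc⁴)²`), and whether the one-shot literal's second form table IS the name `H′₂` (Q-an2-g42-1: partial table vs
total fine second jet — the OWNER's (TN) rule) — DISPLAYED bindings, not asserted.  What STAYS displayed at level 0: the (γ-sym) presentation `hfμ′ hcoarse′`,
`q2` (generator side, leaf-06's currency), the graded Ward rows `a1 a2` (between PINNED tables), `c2 d2` (insertion-table covariance, order 2), `t2` (the
order-2 coarse comb row), `hdead`, `hGt`, the namings.

HONEST DEPENDENCY (page 1, mandatory): continuum YM on T⁴ ⇐ BetaPertH ∧ nine spine estimates (0/9 proved); BetaPertH ⇐ (D1) ∧ (D4) ∧ CAP+tail;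
G-an2-4 gates asym, D1 and NE2/3/4.  HONEST FRAMING (cell contract, verbatim): «discharging `BetaPertH` makes Bałaban's UV stability UNCONDITIONAL —
a real constructive-QFT result; it is NOT the continuum limit and NOT the Clay problem.»  ABSOLUTE RULE (cell charter, verbatim): «No internally-minted
statement may enter as a cited fact. Every hypothesis is either kernel-proved in this package or a verbatim quotation of a PUBLISHED theorem with page
reference. The manuscript(s) under audit are NOT citable for their own disputed steps — they are the thing under adjudication; programme-internal
(2001/route/tribunal) claims are never citable.»  0 estimates; 0∕4 row-D1 binders; NOT (T-ID)∕(T-β) complete, NOT (J-a) complete, NOT SDF, NOT D1, NOT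
BetaPertH, NOT continuum, NOT Clay.  Road «FP», D1 formalisation swarm leaf-02 (b2b-balaban-beta-d1-formalise-leaf-02) gen 22, 2026-08-22.  No existing file
touched.
-/

noncomputable section

open scoped BigOperators Matrix

namespace Summit.QuantumFields.BalabanUV.Beta.FP.NestedStepLawTorusTransportedRowsGradedLevelZeroSymULowClosedLamW2

open Matrix Finset
open Literature.Probability.LatticeModels (Torus.proj)
open Literature.MathematicalPhysics.QuantumFieldTheory.Balaban1983to89
open Literature.MathematicalPhysics.QuantumFieldTheory.Balaban1983to89.Beta
open Literature.MathematicalPhysics.QuantumFieldTheory.Balaban1983to89.Beta.Composition (kkt)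
open Literature.MathematicalPhysics.QuantumFieldTheory.Balaban1983to89.Beta.CompositionSingular (effForm flucCov minOp minOpL)
open Literature.MathematicalPhysics.QuantumFieldTheory.LatticeForm (quo)
open B5Prop11Plancherel (fine)
open B6Lemma24Torus (pbox mem_pbox)
open AffineAveraging (Site box toSite unitVec)
open AveragingContoursRooted (ctr ctrOff ctrOff_mem_box)
open SymAveragingHessianCounts (symVhSAt)
open OneStepResolventKernel (Fib KInv)
open InterLevelTransport (SLam)
open BalabanStepJets (lamCoeffOf)
open Summit.QuantumFields.BalabanUV.Beta.SymAveragingHessianCounts (symHessFFAt)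
open Summit.QuantumFields.BalabanUV.Beta.BorderedHessian (bhKStepAt stepScale)
open Summit.QuantumFields.BalabanUV.Beta.DshAn1 (Dsh)
open Summit.QuantumFields.BalabanUV.Beta.SymShiftedSpread (bhKStepSh)
open Summit.QuantumFields.BalabanUV.Beta.D1BFx.LogDetSecondVariation (secondVar)
open Summit.QuantumFields.BalabanUV.Beta.FP.KernelPeriodisationFib (Idx perF)
open Summit.QuantumFields.BalabanUV.Beta.FP.KernelPeriodisationFibLoc (dper)
open Summit.QuantumFields.BalabanUV.Beta.FP.TorusGaugeCovariance (tdelta tgrad)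
open Summit.QuantumFields.BalabanUV.Beta.FP.TorusGaugeCovarianceCoarse (coarsePt tgradBlock)
open Summit.QuantumFields.BalabanUV.Beta.FP.TorusCombRows (Res combRowsT combBondT)
open Summit.QuantumFields.BalabanUV.Beta.FP.TorusCombNestedBasis (resBigEquiv)
open Summit.QuantumFields.BalabanUV.Beta.GAN24.FineReadoutCauchyFrame (toSite_mem_range)
open StepJetData (wilsonA)
open Summit.QuantumFields.BalabanUV.Beta.FP.NestedStepLawTorusTransportedRowsGradedSym (perF_bhKStepSh_Dsh_ff_eq_perF_bhKStepAt)
open Summit.QuantumFields.BalabanUV.Beta.FP.NestedStepLawTorusTransportedRowsGradedLevelZeroSymULowClosedLam (secondVar_oneShot_nestedStepLaw_torus_transported_graded_rows_levelZero_sym_uLow_closed_lam)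
open Summit.QuantumFields.BalabanUV.Beta.CombWilsonT2PeriodisedK2 (torus_k2_sim_letter torus_H2_transpose)
open ExpKernelCalculus (MKer)
open B4TorusKernel.MultiPeriod (translate)
open WilsonBiStencil (wilsonW₂)
open WilsonVertex2Sym (wsym22)

variable {d : ℕ} (M' : Fin (d + 1) → ℕ) [∀ μ, NeZero (M' μ)] {Lc : ℕ} [NeZero Lc]

set_option synthInstance.maxSize 1024 in
/-- [folklore] **THE GRADED DOOR AT THE (III′) LITERAL (uLow BOTTOM, SOCKETS CLOSED), LEVEL 0, SECOND-ORDER FORM JET BOUND (`w² •` WILSON BI-MEMBER `+ G`): `k2 hH₂t` DISCHARGED BY TERM; displayed only `q2 a1 a2 c2 d2 t2 hdead hGt hfμ′ hcoarse′` + namings.**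
U18's `secondVar_oneShot_nestedStepLaw_torus_transported_graded_rows_levelZero_sym_uLow_closed_lam` with the second-order form jet along `h ⊗ h` bound to
`w² • Σ_b Σ_{b′} (h b·h b′) • H₂^{b,b′} + G` (`hH₂`; `w = −2c`, `c = (Lc^{d+1}·stepScale d Lc 0)⁻¹` — the generator pin `hX` forces `w`, the `k2` word its square;
`H₂^{b,b′}` an2's torus Wilson bi-member, second slot periodised, `hW`; `G` a FREE additive order-2 matrix with DISPLAYED parity `hGt`), and the one-shot literal's
second form jet NAMED `H′₂ := w² • Σ_b Σ_{b′} ((h+Dλ)_b·(h+Dλ)_{b′}) • H₂^{b,b′} + w • (L·E_λ − E_λ·L) + G` (`hH'₂`; `L` = the Λ half of `H₁`); binders `k2 hH₂t`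
REMOVED — supplied inside by an2's `torus_k2_sim_letter` (at `r := ctrOff`, after (β-b) §0; `L :=` the Λ half; the `G` slope by `abel`) and `torus_H2_transpose + hGt`.
Displayed: `q2 a1 a2 c2 d2 t2 hdead hGt hfμ′ hcoarse′`, the namings; conclusion VERBATIM the (III′) call's at level 0. -/
theorem secondVar_oneShot_nestedStepLaw_torus_transported_graded_rows_levelZero_sym_uLow_closed_lam_w2 (hM' : ∀ i, Lc ∣ M' i)
    {κ : Type*} [Fintype κ] [DecidableEq κ] (pμ' : κ → ↥(pbox M')) (mμ' : κ → Fin (d + 1))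
    (hfμ' : Function.Injective (fun a : κ => ((pμ' a, Sum.inr (mμ' a)) : Idx M' (Fib d))))
    (hcoarse' : ∀ (s : ↥(pbox M')) (m : Fin (d + 1)),
      ((s, Sum.inr m) : Idx M' (Fib d)) ∈ Set.range (fun a : κ => ((pμ' a, Sum.inr (mμ' a)) : Idx M' (Fib d))) ↔ Torus.proj Lc (s : Site (d + 1)) = 0)
    -- the torus objects of record, by defining equations
    {H₀ : Matrix (↥(pbox (fine Lc M')) × Fin (d + 1)) (↥(pbox (fine Lc M')) × Fin (d + 1)) ℝ}
    {Q₁₀ : Matrix (↥(pbox M') × Fin (d + 1)) (↥(pbox (fine Lc M')) × Fin (d + 1)) ℝ}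
    {τ₁ : Matrix (Res (ctr (d + 1) Lc) Lc (fine Lc M')) (↥(pbox (fine Lc M')) × Fin (d + 1)) ℝ}
    {τ₂ : Matrix (Res (ctr (d + 1) Lc) Lc M') (↥(pbox M') × Fin (d + 1)) ℝ}
    {D₁ : Matrix (↥(pbox (fine Lc M')) × Fin (d + 1)) (Res (ctr (d + 1) Lc) Lc (fine Lc M')) ℝ}
    {D₂ : Matrix (↥(pbox (fine Lc M')) × Fin (d + 1)) (Res (ctr (d + 1) Lc) Lc M') ℝ}
    {Dbar : Matrix (↥(pbox M') × Fin (d + 1)) (Res (ctr (d + 1) Lc) Lc M') ℝ}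
    {P : Matrix (Res (ctr (d + 1) Lc) Lc M' ⊕ Res (ctr (d + 1) Lc) Lc (fine Lc M')) (↥(pbox (fine Lc M')) × Fin (d + 1)) ℝ}
    (hH₀ : H₀ = (perF (fine Lc M') (bhKStepSh d Lc (Dsh Lc) 0)).submatrix
        (fun b : ↥(pbox (fine Lc M')) × Fin (d + 1) => ((b.1, Sum.inl b.2) : Idx (fine Lc M') (Fib d)))
        (fun b : ↥(pbox (fine Lc M')) × Fin (d + 1) => ((b.1, Sum.inl b.2) : Idx (fine Lc M') (Fib d))))
    (hQ₁₀ : Q₁₀ = (perF (fine Lc M') (bhKStepSh d Lc (Dsh Lc) 0)).submatrix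
        (fun a : ↥(pbox M') × Fin (d + 1) => ((coarsePt M' Lc a.1, Sum.inr a.2) : Idx (fine Lc M') (Fib d)))
        (fun b : ↥(pbox (fine Lc M')) × Fin (d + 1) => ((b.1, Sum.inl b.2) : Idx (fine Lc M') (Fib d))))
    (hτ₁ : τ₁ = (combRowsT (ctr (d + 1) Lc) Lc (fine Lc M')).submatrix id
        (fun b : ↥(pbox (fine Lc M')) × Fin (d + 1) => ((b.1, Sum.inl b.2) : Idx (fine Lc M') (Fib d))))
    (hτ₂ : τ₂ = (combRowsT (ctr (d + 1) Lc) Lc M').submatrix id (fun b : ↥(pbox M') × Fin (d + 1) => ((b.1, Sum.inl b.2) : Idx M' (Fib d))))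
    (hD₁ : D₁ = (tgrad (fine Lc M')).submatrix (fun b : ↥(pbox (fine Lc M')) × Fin (d + 1) => ((b.1, Sum.inl b.2) : Idx (fine Lc M') (Fib d)))
        (Subtype.val : Res (ctr (d + 1) Lc) Lc (fine Lc M') → ↥(pbox (fine Lc M'))))
    (hD₂ : D₂ = (tgradBlock M' Lc).submatrix (fun b : ↥(pbox (fine Lc M')) × Fin (d + 1) => ((b.1, Sum.inl b.2) : Idx (fine Lc M') (Fib d)))
        (Subtype.val : Res (ctr (d + 1) Lc) Lc M' → ↥(pbox M')))
    (hDbar : Dbar = Matrix.of fun (a : ↥(pbox M') × Fin (d + 1)) (t : Res (ctr (d + 1) Lc) Lc M') =>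
        stepScale d Lc 0 * (((box (d + 1) Lc).card : ℝ) * tgrad M' (a.1, Sum.inl a.2) t.1))
    (hP : P = (combRowsT ((Lc : ℤ) • ctr (d + 1) Lc + ctr (d + 1) Lc) (Lc * Lc) (fine Lc M')).submatrix
        (resBigEquiv Lc Lc (ctr (d + 1) Lc) (ctr (d + 1) Lc) M' (Nat.pos_of_ne_zero (NeZero.ne Lc)) (toSite_mem_range (ctrOff_mem_box (Nat.one_le_iff_ne_zero.mpr (NeZero.ne Lc))))
          (Nat.pos_of_ne_zero (NeZero.ne Lc)) (toSite_mem_range (ctrOff_mem_box (Nat.one_le_iff_ne_zero.mpr (NeZero.ne Lc))))).symm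
        (fun b : ↥(pbox (fine Lc M')) × Fin (d + 1) => ((b.1, Sum.inl b.2) : Idx (fine Lc M') (Fib d))))
    -- the displayed jets: averaging (both levels), block covariance, generators (fine and coarse), Ward witnesses
    {Q₂₀ : Matrix κ (↥(pbox M') × Fin (d + 1)) ℝ}
    (hQ₂₀ : Q₂₀ = (perF M' (bhKStepSh d Lc (Dsh Lc) 1)).submatrix (fun a : κ => ((pμ' a, Sum.inr (mμ' a)) : Idx M' (Fib d)))
        (fun b : ↥(pbox M') × Fin (d + 1) => ((b.1, Sum.inl b.2) : Idx M' (Fib d))))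
    -- leaf-02's ORDER-1 ROWS ALONG A DIRECTION `h` AND THE GAUGE PARAMETER `λ` OF THE CHART TRANSPORT: the insertion-table families (fine, and coarse
    -- transported by `θ_j·Q₁₀`), the generator jet and the coarse jet by their defining equations (p314580, `PeriodisedCoarseWardContact`, `NestedStepLawTorusInstanceRows`)
    (h : ↥(pbox (fine Lc M')) × Fin (d + 1) → ℝ) (lam : ↥(pbox (fine Lc M')) → ℝ)
    (Q₁₁ : (↥(pbox (fine Lc M')) × Fin (d + 1) → ℝ) → Matrix (↥(pbox M') × Fin (d + 1)) (↥(pbox (fine Lc M')) × Fin (d + 1)) ℝ)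
    (hQ₁₁ : ∀ w, Q₁₁ w = ∑ b : ↥(pbox (fine Lc M')) × Fin (d + 1), w b •
        (perF (fine Lc M') (dper (fine Lc M') (symVhSAt (ctr (d + 1) Lc) d Lc rfl b.2 (b.1 : Site (d + 1))))).submatrix
          (fun a : ↥(pbox M') × Fin (d + 1) => ((coarsePt M' Lc a.1, Sum.inr a.2) : Idx (fine Lc M') (Fib d)))
          (fun b : ↥(pbox (fine Lc M')) × Fin (d + 1) => ((b.1, Sum.inl b.2) : Idx (fine Lc M') (Fib d))))
    (Q₂₁ : (↥(pbox (fine Lc M')) × Fin (d + 1) → ℝ) → Matrix κ (↥(pbox M') × Fin (d + 1)) ℝ)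
    (hQ₂₁ : ∀ w, Q₂₁ w = ∑ b : ↥(pbox (fine Lc M')) × Fin (d + 1), w b •
        ∑ a' : ↥(pbox M') × Fin (d + 1), (stepScale d Lc 1 / (stepScale d Lc 0 ^ 2 * ((box (d + 1) Lc).card : ℝ)) * Q₁₀ a' b) •
          (perF M' (dper M' (symVhSAt (ctr (d + 1) Lc) d Lc rfl a'.2 (a'.1 : Site (d + 1))))).submatrix (fun a : κ => ((pμ' a, Sum.inr (mμ' a)) : Idx M' (Fib d)))
            (fun b : ↥(pbox M') × Fin (d + 1) => ((b.1, Sum.inl b.2) : Idx M' (Fib d))))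
    {W₁ : Matrix (↥(pbox (fine Lc M')) × Fin (d + 1)) (Res (ctr (d + 1) Lc) Lc M' ⊕ Res (ctr (d + 1) Lc) Lc (fine Lc M')) ℝ}
    (hW₁ : W₁ = ∑ b : ↥(pbox (fine Lc M')) × Fin (d + 1), h b •
        Matrix.of (fun (b' : ↥(pbox (fine Lc M')) × Fin (d + 1)) (e : Res (ctr (d + 1) Lc) Lc M' ⊕ Res (ctr (d + 1) Lc) Lc (fine Lc M')) =>
          if b' = b then
            -((((Lc : ℝ) ^ (d + 1) * stepScale d Lc 0)⁻¹)
              * Sum.elim (fun t : Res (ctr (d + 1) Lc) Lc M' => tdelta M' (quo Lc ((b.1 : Site (d + 1)) + unitVec b.2)) t.1)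
                  (fun s : Res (ctr (d + 1) Lc) Lc (fine Lc M') => tdelta (fine Lc M') ((b.1 : Site (d + 1)) + unitVec b.2) s.1) e)
          else 0))
    {Db₁ : Matrix (↥(pbox M') × Fin (d + 1)) (Res (ctr (d + 1) Lc) Lc M') ℝ}
    (hDb₁ : Db₁ = ∑ b : ↥(pbox (fine Lc M')) × Fin (d + 1), h b •
        Matrix.of fun (a : ↥(pbox M') × Fin (d + 1)) (t : Res (ctr (d + 1) Lc) Lc M') =>
          -((((Lc : ℝ) ^ (d + 1) * stepScale d Lc 0)⁻¹) * Q₁₀ a b * tdelta M' ((a.1 : Site (d + 1)) + unitVec a.2) t.1))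
    -- LEVEL 0: the first-order FORM family along `h` IS `(−2c) •` leaf-05's periodised WILSON family (`PeriodisedFormIndexWard`; an3's `wilsonA`),
    -- the weight `−2c` forced by the generator pin `hX` (displayed binding — the dictionary's identification of the level-0 form slot, not asserted here)
    -- the Λ-SECTOR HALF of the FULL first-order (fields, fields) jet PINNED to an2 g41's Λ family of record (`CombLamSectorPeriodised`, level 0:
    -- `SLam Lc (lamCoeffOf KInv Lc) (symHessFFAt ρ_c Lc)`, periodised on (ff)), at a DISPLAYED weight `w` (the dictionary's normalisation letter)
    (w : ℝ)
    {H₁ : Matrix (↥(pbox (fine Lc M')) × Fin (d + 1)) (↥(pbox (fine Lc M')) × Fin (d + 1)) ℝ}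
    (hH₁ : H₁ = ((-2 : ℝ) * (((Lc : ℝ) ^ (d + 1) * stepScale d Lc 0)⁻¹)) • (∑ b : ↥(pbox (fine Lc M')) × Fin (d + 1), h b •
        (perF (fine Lc M') (dper (fine Lc M') (wilsonA d b.2 (b.1 : Site (d + 1))))).submatrix
          (fun b : ↥(pbox (fine Lc M')) × Fin (d + 1) => ((b.1, Sum.inl b.2) : Idx (fine Lc M') (Fib d)))
          (fun b : ↥(pbox (fine Lc M')) × Fin (d + 1) => ((b.1, Sum.inl b.2) : Idx (fine Lc M') (Fib d))))
      + ∑ b : ↥(pbox (fine Lc M')) × Fin (d + 1), h b •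
        (w • (perF (fine Lc M') (dper (fine Lc M')
            (SLam Lc (lamCoeffOf (KInv (N := Lc) (d := d)) Lc) (symHessFFAt (ctr (d + 1) Lc) Lc) b.2 (b.1 : Site (d + 1))))).submatrix
          (fun b : ↥(pbox (fine Lc M')) × Fin (d + 1) => ((b.1, Sum.inl b.2) : Idx (fine Lc M') (Fib d)))
          (fun b : ↥(pbox (fine Lc M')) × Fin (d + 1) => ((b.1, Sum.inl b.2) : Idx (fine Lc M') (Fib d)))))
    -- LEVEL 0, ORDER 2 ((α-3)-W, an2 g42 `CombWilsonT2Periodised(K2)`): the SECOND-order FORM family along `h ⊗ h` IS `w² •` the torus bi-member of an3's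
    -- order-2 Wilson table `T₂ := wilsonW₂ d ((8N²)⁻¹ • wsym22 N)` with its SECOND slot summed over the period copies (`hW`, an2's spelling VERBATIM), `w = −2c`
    -- (displayed binding — the dictionary's identification of the level-0 order-2 form slot, not asserted here), PLUS a FREE ADDITIVE order-2 matrix `G`
    -- (`0` under Q-an2-g42-1 (a) — the border table is ff-free —, the Λ-companions under (b); the OWNER's word) whose parity `hGt` is DISPLAYED
    {N : ℕ} (hN : 2 ≤ N)
    {W : Fin (d + 1) → Site (d + 1) → Fin (d + 1) → Site (d + 1) → MKer (d + 1) (Fib d)}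
    (hW : W = fun κ' u' κ u x z a c =>
      ∑' n : Site (d + 1), wilsonW₂ d ((8 * (N : ℝ) ^ 2)⁻¹ • wsym22 N) κ u κ' (translate (fine Lc M') u' n) x z a c)
    (G : Matrix (↥(pbox (fine Lc M')) × Fin (d + 1)) (↥(pbox (fine Lc M')) × Fin (d + 1)) ℝ) (hGt : Gᵀ = G)
    {H₂ : Matrix (↥(pbox (fine Lc M')) × Fin (d + 1)) (↥(pbox (fine Lc M')) × Fin (d + 1)) ℝ}
    (hH₂ : H₂ = ((-2 : ℝ) * (((Lc : ℝ) ^ (d + 1) * stepScale d Lc 0)⁻¹)) ^ 2 •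
        (∑ b : ↥(pbox (fine Lc M')) × Fin (d + 1), ∑ b' : ↥(pbox (fine Lc M')) × Fin (d + 1), (h b * h b') •
          (perF (fine Lc M') (dper (fine Lc M') (W b'.2 (b'.1 : Site (d + 1)) b.2 (b.1 : Site (d + 1))))).submatrix
            (fun c : ↥(pbox (fine Lc M')) × Fin (d + 1) => ((c.1, Sum.inl c.2) : Idx (fine Lc M') (Fib d)))
            (fun c : ↥(pbox (fine Lc M')) × Fin (d + 1) => ((c.1, Sum.inl c.2) : Idx (fine Lc M') (Fib d))))
      + G)
    -- the NESTED chart's direction is average-coarse-comb-dead (the hypothesis of `torus_t1_of_average_dead`)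
    (hdead : ∀ (a : ↥(pbox M') × Fin (d + 1)) (x : Res (ctr (d + 1) Lc) Lc M'),
      combBondT (ctr (d + 1) Lc) Lc M' x = ((a.1, Sum.inl a.2) : Idx M' (Fib d)) → ∑ b : ↥(pbox (fine Lc M')) × Fin (d + 1), Q₁₀ a b * h b = 0)
    -- the second-order data stay displayed
    (Q₁₂ : Matrix (↥(pbox M') × Fin (d + 1)) (↥(pbox (fine Lc M')) × Fin (d + 1)) ℝ) (Q₂₂ : Matrix κ (↥(pbox M') × Fin (d + 1)) ℝ)
    -- leaf-06's EXPONENTIAL closed form of the nested chart's generator SECOND jet along `h` (`TorusGeneratorIntertwiningTwo.torus_j2`'s `hW₂`)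
    {W₂ : Matrix (↥(pbox (fine Lc M')) × Fin (d + 1)) (Res (ctr (d + 1) Lc) Lc M' ⊕ Res (ctr (d + 1) Lc) Lc (fine Lc M')) ℝ}
    (hW₂ : W₂ = Matrix.of fun (b : ↥(pbox (fine Lc M')) × Fin (d + 1)) (e : Res (ctr (d + 1) Lc) Lc M' ⊕ Res (ctr (d + 1) Lc) Lc (fine Lc M')) =>
        ((((Lc : ℝ) ^ (d + 1) * stepScale d Lc 0)⁻¹) * h b) ^ 2 * Sum.elim (fun t : Res (ctr (d + 1) Lc) Lc M' => tdelta M' (quo Lc ((b.1 : Site (d + 1)) + unitVec b.2)) t.1)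
          (fun s : Res (ctr (d + 1) Lc) Lc (fine Lc M') => tdelta (fine Lc M') ((b.1 : Site (d + 1)) + unitVec b.2) s.1) e)
    (Db₂ : Matrix (↥(pbox M') × Fin (d + 1)) (Res (ctr (d + 1) Lc) Lc M') ℝ)
    (Y₁ Y₂ : Matrix κ (Res (ctr (d + 1) Lc) Lc M' ⊕ Res (ctr (d + 1) Lc) Lc (fine Lc M')) ℝ)
    -- the chart transport (exponential currency): generators `X` (fields), `X̄` (composite multipliers); the one-shot chart's generator jets `W♯₁ W♯₂`;
    -- the parameter-transport jets `C₁ C₂`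
    {X : Matrix (↥(pbox (fine Lc M')) × Fin (d + 1)) (↥(pbox (fine Lc M')) × Fin (d + 1)) ℝ} {Xbar : Matrix κ κ ℝ}
    -- (T-β-1) at the torus: the transport generators ARE the diagonal gauge generators of the parameter `λ` (fields: `−c•E_λ`; composite multipliers: `c•R′_λ̄`)
    (hX : X = -((((Lc : ℝ) ^ (d + 1) * stepScale d Lc 0)⁻¹) • Matrix.diagonal (fun b : ↥(pbox (fine Lc M')) × Fin (d + 1) => lam b.1)))
    (hXbar : Xbar = (((Lc : ℝ) ^ (d + 1) * stepScale d Lc 0)⁻¹) •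
        Matrix.diagonal (fun α : κ => ∑ t : ↥(pbox M'), tdelta M' ((pμ' α : Site (d + 1)) + ctr (d + 1) Lc) t
          * (∑ s : ↥(pbox (fine Lc M')), tdelta (fine Lc M') ((Lc : ℤ) • (t : Site (d + 1)) + ctr (d + 1) Lc) s * lam s)))
    -- (T-β-4) AT THE TORUS (leaf-06 `TorusGeneratorIntertwining`): the one-shot chart's generator first jet IS the nested chart's generator jet ALONG THE
    -- GAUGE-SHIFTED DIRECTION `h + Dλ`, by its defining equation in closed form (`weightedJet_eq` currency)
    {W'₁ : Matrix (↥(pbox (fine Lc M')) × Fin (d + 1)) (Res (ctr (d + 1) Lc) Lc M' ⊕ Res (ctr (d + 1) Lc) Lc (fine Lc M')) ℝ}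
    (hW'₁ : W'₁ = Matrix.of fun (b : ↥(pbox (fine Lc M')) × Fin (d + 1)) (e : Res (ctr (d + 1) Lc) Lc M' ⊕ Res (ctr (d + 1) Lc) Lc (fine Lc M')) =>
        -((((Lc : ℝ) ^ (d + 1) * stepScale d Lc 0)⁻¹) * (h b + ∑ s, tgrad (fine Lc M') (b.1, Sum.inl b.2) s * lam s)
          * Sum.elim (fun t : Res (ctr (d + 1) Lc) Lc M' => tdelta M' (quo Lc ((b.1 : Site (d + 1)) + unitVec b.2)) t.1)
            (fun s : Res (ctr (d + 1) Lc) Lc (fine Lc M') => tdelta (fine Lc M') ((b.1 : Site (d + 1)) + unitVec b.2) s.1) e))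
    -- the one-shot chart's generator SECOND jet along `h + Dλ`, exponential closed form (`torus_j2`'s `hW₂'`, `torus_uP_exp`'s `hW₂` at `w := h + Dλ`)
    {W'₂ : Matrix (↥(pbox (fine Lc M')) × Fin (d + 1)) (Res (ctr (d + 1) Lc) Lc M' ⊕ Res (ctr (d + 1) Lc) Lc (fine Lc M')) ℝ}
    (hW'₂ : W'₂ = Matrix.of fun (b : ↥(pbox (fine Lc M')) × Fin (d + 1)) (e : Res (ctr (d + 1) Lc) Lc M' ⊕ Res (ctr (d + 1) Lc) Lc (fine Lc M')) =>
        ((((Lc : ℝ) ^ (d + 1) * stepScale d Lc 0)⁻¹) * (h b + ∑ s, tgrad (fine Lc M') (b.1, Sum.inl b.2) s * lam s)) ^ 2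
          * Sum.elim (fun t : Res (ctr (d + 1) Lc) Lc M' => tdelta M' (quo Lc ((b.1 : Site (d + 1)) + unitVec b.2)) t.1)
            (fun s : Res (ctr (d + 1) Lc) Lc (fine Lc M') => tdelta (fine Lc M') ((b.1 : Site (d + 1)) + unitVec b.2) s.1) e)
    -- the parameter-transport GENERATOR `C₁(λ)` by leaf-06's defining equation `hC₁` VERBATIM («multiplication by `λ` in the gauge-mode basis»: `diagonal λ̄`
    -- on the coarse residual parameters, `diagonal (λ∘val)` on the fine ones, coarse-to-fine block `(λ s − λ̄ t)·[block s = t]`); the transport is `c • C₁`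
    {C₁ : Matrix (Res (ctr (d + 1) Lc) Lc M' ⊕ Res (ctr (d + 1) Lc) Lc (fine Lc M')) (Res (ctr (d + 1) Lc) Lc M' ⊕ Res (ctr (d + 1) Lc) Lc (fine Lc M')) ℝ}
    (hC₁ : C₁ = Matrix.fromBlocks
        (Matrix.diagonal fun t : Res (ctr (d + 1) Lc) Lc M' =>
          ∑ s, tdelta (fine Lc M') ((Lc : ℤ) • ((t.1 : ↥(pbox M')) : Site (d + 1)) + ctr (d + 1) Lc) s * lam s)
        (0 : Matrix (Res (ctr (d + 1) Lc) Lc M') (Res (ctr (d + 1) Lc) Lc (fine Lc M')) ℝ)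
        (Matrix.of fun (s : Res (ctr (d + 1) Lc) Lc (fine Lc M')) (t : Res (ctr (d + 1) Lc) Lc M') =>
          (lam s.1 - ∑ s', tdelta (fine Lc M') ((Lc : ℤ) • ((t.1 : ↥(pbox M')) : Site (d + 1)) + ctr (d + 1) Lc) s' * lam s')
            * tdelta M' (quo Lc ((s.1 : ↥(pbox (fine Lc M'))) : Site (d + 1))) t.1)
        (Matrix.diagonal fun s : Res (ctr (d + 1) Lc) Lc (fine Lc M') => lam s.1))
    {𝔔₀ 𝔔₁ 𝔔₂ : Matrix κ (↥(pbox (fine Lc M')) × Fin (d + 1)) ℝ}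
    (h𝔔₀ : Q₂₀ * Q₁₀ = 𝔔₀) (h𝔔₁ : Q₂₁ h * Q₁₀ + Q₂₀ * Q₁₁ h = 𝔔₁)
    (h𝔔₂ : Q₂₂ * Q₁₀ + Q₂₁ h * Q₁₁ h + (Q₂₁ h * Q₁₁ h + Q₂₀ * Q₁₂) = 𝔔₂)
    -- (T-β-1) GRADED, ORDER 2, LEVEL 0: the ONE-SHOT literal's second form jet NAMED by the `k2` word (`k2` DISCHARGED: an2 `torus_k2_sim_letter`) —
    -- `w² •` the Wilson bi-member along the GAUGE-SHIFTED pair `(h + Dλ) ⊗ (h + Dλ)`, PLUS the commutator of the Λ half of `H₁` with the generator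
    -- `E_λ` (weight `w`), PLUS `G` un-shifted (representative (a) of Q-an2-g42-1; no order-2 index law asserted)
    {H'₂ : Matrix (↥(pbox (fine Lc M')) × Fin (d + 1)) (↥(pbox (fine Lc M')) × Fin (d + 1)) ℝ}
    (hH'₂ : H'₂ = ((-2 : ℝ) * (((Lc : ℝ) ^ (d + 1) * stepScale d Lc 0)⁻¹)) ^ 2 •
        (∑ b : ↥(pbox (fine Lc M')) × Fin (d + 1), ∑ b' : ↥(pbox (fine Lc M')) × Fin (d + 1),
          ((h b + ∑ s : ↥(pbox (fine Lc M')), tgrad (fine Lc M') (b.1, Sum.inl b.2) s * lam s)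
            * (h b' + ∑ s : ↥(pbox (fine Lc M')), tgrad (fine Lc M') (b'.1, Sum.inl b'.2) s * lam s)) •
          (perF (fine Lc M') (dper (fine Lc M') (W b'.2 (b'.1 : Site (d + 1)) b.2 (b.1 : Site (d + 1))))).submatrix
            (fun c : ↥(pbox (fine Lc M')) × Fin (d + 1) => ((c.1, Sum.inl c.2) : Idx (fine Lc M') (Fib d)))
            (fun c : ↥(pbox (fine Lc M')) × Fin (d + 1) => ((c.1, Sum.inl c.2) : Idx (fine Lc M') (Fib d))))
      + ((-2 : ℝ) * (((Lc : ℝ) ^ (d + 1) * stepScale d Lc 0)⁻¹)) •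
        ((∑ b : ↥(pbox (fine Lc M')) × Fin (d + 1), h b •
            (w • (perF (fine Lc M') (dper (fine Lc M')
              (SLam Lc (lamCoeffOf (KInv (N := Lc) (d := d)) Lc) (symHessFFAt (ctr (d + 1) Lc) Lc) b.2 (b.1 : Site (d + 1))))).submatrix
            (fun b : ↥(pbox (fine Lc M')) × Fin (d + 1) => ((b.1, Sum.inl b.2) : Idx (fine Lc M') (Fib d)))
            (fun b : ↥(pbox (fine Lc M')) × Fin (d + 1) => ((b.1, Sum.inl b.2) : Idx (fine Lc M') (Fib d)))))
          * Matrix.diagonal (fun b : ↥(pbox (fine Lc M')) × Fin (d + 1) => lam b.1)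
        - Matrix.diagonal (fun b : ↥(pbox (fine Lc M')) × Fin (d + 1) => lam b.1)
          * (∑ b : ↥(pbox (fine Lc M')) × Fin (d + 1), h b •
            (w • (perF (fine Lc M') (dper (fine Lc M')
              (SLam Lc (lamCoeffOf (KInv (N := Lc) (d := d)) Lc) (symHessFFAt (ctr (d + 1) Lc) Lc) b.2 (b.1 : Site (d + 1))))).submatrix
            (fun b : ↥(pbox (fine Lc M')) × Fin (d + 1) => ((b.1, Sum.inl b.2) : Idx (fine Lc M') (Fib d)))
            (fun b : ↥(pbox (fine Lc M')) × Fin (d + 1) => ((b.1, Sum.inl b.2) : Idx (fine Lc M') (Fib d))))))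
      + G)
    -- LEVEL 0: the ONE-SHOT literal's first form jet IS the same weighted Wilson family along the GAUGE-SHIFTED direction `h + Dλ` (`k1` DISCHARGED:
    -- leaf-05 `torus_k1_sim_letter`)
    {H'₁ : Matrix (↥(pbox (fine Lc M')) × Fin (d + 1)) (↥(pbox (fine Lc M')) × Fin (d + 1)) ℝ}
    (hH'₁ : H'₁ = ((-2 : ℝ) * (((Lc : ℝ) ^ (d + 1) * stepScale d Lc 0)⁻¹)) • (∑ b : ↥(pbox (fine Lc M')) × Fin (d + 1),
        (h b + ∑ s : ↥(pbox (fine Lc M')), tgrad (fine Lc M') (b.1, Sum.inl b.2) s * lam s) •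
          (perF (fine Lc M') (dper (fine Lc M') (wilsonA d b.2 (b.1 : Site (d + 1))))).submatrix
          (fun b : ↥(pbox (fine Lc M')) × Fin (d + 1) => ((b.1, Sum.inl b.2) : Idx (fine Lc M') (Fib d)))
          (fun b : ↥(pbox (fine Lc M')) × Fin (d + 1) => ((b.1, Sum.inl b.2) : Idx (fine Lc M') (Fib d))))
      + ∑ b : ↥(pbox (fine Lc M')) × Fin (d + 1), (h b + ∑ s : ↥(pbox (fine Lc M')), tgrad (fine Lc M') (b.1, Sum.inl b.2) s * lam s) •
        (w • (perF (fine Lc M') (dper (fine Lc M')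
            (SLam Lc (lamCoeffOf (KInv (N := Lc) (d := d)) Lc) (symHessFFAt (ctr (d + 1) Lc) Lc) b.2 (b.1 : Site (d + 1))))).submatrix
          (fun b : ↥(pbox (fine Lc M')) × Fin (d + 1) => ((b.1, Sum.inl b.2) : Idx (fine Lc M') (Fib d)))
          (fun b : ↥(pbox (fine Lc M')) × Fin (d + 1) => ((b.1, Sum.inl b.2) : Idx (fine Lc M') (Fib d)))))
    {𝔔'₁ 𝔔'₂ : Matrix κ (↥(pbox (fine Lc M')) × Fin (d + 1)) ℝ}
    -- `q1` DISCHARGED (`PeriodisedCompositeIndexWard.torus_q1_letter`): the one-shot literal's first composite averaging jet IS the composite insertion jet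
    -- along the GAUGE-SHIFTED direction `h + Dλ`, NAMED
    (h𝔔'₁ : Q₂₁ (fun b => h b + ∑ s : ↥(pbox (fine Lc M')), tgrad (fine Lc M') (b.1, Sum.inl b.2) s * lam s) * Q₁₀
        + Q₂₀ * Q₁₁ (fun b => h b + ∑ s : ↥(pbox (fine Lc M')), tgrad (fine Lc M') (b.1, Sum.inl b.2) s * lam s) = 𝔔'₁)
    (q2 : Xbar * Xbar * 𝔔₀ + (Xbar * 𝔔₁ + Xbar * 𝔔₀ * X) + ((Xbar * 𝔔₁ + Xbar * 𝔔₀ * X) + (𝔔₂ + 𝔔₁ * X + (𝔔₁ * X + 𝔔₀ * (X * X)))) = 𝔔'₂)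
    -- (T-β-4) `j1 j2 uC` and the one-shot (UNI)-jet letter `uP'` DISCHARGED (leaf-06); dead rows of the nested chart stay: the small comb rows, and
    -- the order-2 coarse comb row of the average (`t1` DISCHARGED)
    (t2 : τ₂ * (Q₁₂ * fromCols D₂ D₁ + (2 : ℝ) • (Q₁₁ h * W₁) + Q₁₀ * W₂) = 0)
    -- (`hH₂t` DISCHARGED: an2 `torus_H2_transpose` + the displayed `hGt`)
    -- the GRADED second-order composite Ward TABLE IDENTITIES (δ-constrained: `𝔎 = H`; the door's one-sided graded shapes, `W₀ := [D₂ | D₁]`), read at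
    -- `Y₀ = 0`; orders 1 and 2 only (order 0 `a0` DISCHARGED: `PeriodisedWardOrderZero.torus_a0_letter`); NO transposed rows
    (a1 : H₁ * fromCols D₂ D₁ + H₀ * W₁ = 𝔔₀ᵀ * Y₁)
    (a2 : H₂ * fromCols D₂ D₁ + (2 : ℝ) • (H₁ * W₁) + H₀ * W₂ = -((2 : ℝ) • (𝔔₁ᵀ * Y₁)) + 𝔔₀ᵀ * Y₂)
    -- the insertion-table covariance TABLE IDENTITIES and the coarse covariance identities (order 0 discharged in p316503)
    -- order 2 only (order 1 `c1 d1` DISCHARGED: p314580, `PeriodisedCoarseWardContact`)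
    (c2 : Q₁₂ * fromCols D₂ D₁ + (2 : ℝ) • (Q₁₁ h * W₁) + Q₁₀ * W₂ = fromCols Db₂ 0)
    (d2 : Q₂₂ * Dbar + (2 : ℝ) • (Q₂₁ h * Db₁) + Q₂₀ * Db₂ = 0)
    -- block namings and the coarse non-degeneracy
    {Γ : Matrix (↥(pbox (fine Lc M')) × Fin (d + 1)) (↥(pbox (fine Lc M')) × Fin (d + 1)) ℝ}
    {I : Matrix (↥(pbox (fine Lc M')) × Fin (d + 1)) ((↥(pbox M') × Fin (d + 1)) ⊕ Res (ctr (d + 1) Lc) Lc (fine Lc M')) ℝ}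
    {L : Matrix ((↥(pbox M') × Fin (d + 1)) ⊕ Res (ctr (d + 1) Lc) Lc (fine Lc M')) (↥(pbox (fine Lc M')) × Fin (d + 1)) ℝ}
    {S : Matrix ((↥(pbox M') × Fin (d + 1)) ⊕ Res (ctr (d + 1) Lc) Lc (fine Lc M')) ((↥(pbox M') × Fin (d + 1)) ⊕ Res (ctr (d + 1) Lc) Lc (fine Lc M')) ℝ}
    {B : Matrix ((↥(pbox M') × Fin (d + 1)) ⊕ Res (ctr (d + 1) Lc) Lc (fine Lc M')) (↥(pbox (fine Lc M')) × Fin (d + 1)) ℝ}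
    (hΓ : flucCov H₀ (fromRows Q₁₀ τ₁) = Γ) (hI : minOp H₀ (fromRows Q₁₀ τ₁) = I) (hL : minOpL H₀ (fromRows Q₁₀ τ₁) = L) (hS : effForm H₀ (fromRows Q₁₀ τ₁) = S)
    (hB : fromRows (Q₁₁ h) (0 : Matrix (Res (ctr (d + 1) Lc) Lc (fine Lc M')) (↥(pbox (fine Lc M')) × Fin (d + 1)) ℝ) = B) :
    secondVar (kkt H₀ (fromRows 𝔔₀ P))
        (fromBlocks H'₁ (-(fromRows 𝔔'₁ (0 : Matrix (Res (ctr (d + 1) Lc) Lc M' ⊕ Res (ctr (d + 1) Lc) Lc (fine Lc M')) (↥(pbox (fine Lc M')) × Fin (d + 1)) ℝ))ᵀ)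
          (fromRows 𝔔'₁ (0 : Matrix (Res (ctr (d + 1) Lc) Lc M' ⊕ Res (ctr (d + 1) Lc) Lc (fine Lc M')) (↥(pbox (fine Lc M')) × Fin (d + 1)) ℝ)) 0)
        (kkt H'₂ (fromRows 𝔔'₂ (0 : Matrix (Res (ctr (d + 1) Lc) Lc M' ⊕ Res (ctr (d + 1) Lc) Lc (fine Lc M')) (↥(pbox (fine Lc M')) × Fin (d + 1)) ℝ)))
      = secondVar (kkt H₀ (fromRows Q₁₀ τ₁)) (fromBlocks H₁ (-Bᵀ) B 0)
            (kkt H₂ (fromRows Q₁₂ (0 : Matrix (Res (ctr (d + 1) Lc) Lc (fine Lc M')) (↥(pbox (fine Lc M')) × Fin (d + 1)) ℝ)))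
        + secondVar
            (kkt S.toBlocks₁₁ (fromRows Q₂₀ τ₂))
            (fromBlocks ((L * H₁ - S * B) * I + L * Bᵀ * S).toBlocks₁₁ (-(fromRows (Q₂₁ h) (0 : Matrix (Res (ctr (d + 1) Lc) Lc M') (↥(pbox M') × Fin (d + 1)) ℝ))ᵀ)
              (fromRows (Q₂₁ h) (0 : Matrix (Res (ctr (d + 1) Lc) Lc M') (↥(pbox M') × Fin (d + 1)) ℝ)) 0)
            (kkt (((-((L * H₁ - S * B) * Γ - L * Bᵀ * L) * H₁ + L * H₂
                      - (((L * H₁ - S * B) * I + L * Bᵀ * S) * B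
                          + S * fromRows Q₁₂ (0 : Matrix (Res (ctr (d + 1) Lc) Lc (fine Lc M')) (↥(pbox (fine Lc M')) × Fin (d + 1)) ℝ))) * I
                    + (L * H₁ - S * B) * (-((Γ * H₁ + I * B) * I + Γ * Bᵀ * S)))
                  - ((-((L * H₁ - S * B) * Γ - L * Bᵀ * L) * (-Bᵀ)
                        + L * (fromRows Q₁₂ (0 : Matrix (Res (ctr (d + 1) Lc) Lc (fine Lc M')) (↥(pbox (fine Lc M')) × Fin (d + 1)) ℝ))ᵀ) * S
                      + L * (-Bᵀ) * ((L * H₁ - S * B) * I + L * Bᵀ * S))).toBlocks₁₁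
              (fromRows Q₂₂ (0 : Matrix (Res (ctr (d + 1) Lc) Lc M') (↥(pbox M') × Fin (d + 1)) ℝ))) := by
  subst hH₁ hH₂ hH'₂
  -- the form block of `𝕄_0` on (fields, fields) IS the rooted level-0 candidate's at the centred root ((β-b) §0) — an2's `hH₀` spelling
  have hH₀' := hH₀.trans (perF_bhKStepSh_Dsh_ff_eq_perF_bhKStepAt (fine Lc M') 0)
  exact secondVar_oneShot_nestedStepLaw_torus_transported_graded_rows_levelZero_sym_uLow_closed_lam M' hM' pμ' mμ' hfμ' hcoarse' hH₀ hQ₁₀ hτ₁ hτ₂ hD₁ hD₂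
    hDbar hP _ hQ₂₀ h lam Q₁₁ hQ₁₁ Q₂₁ hQ₂₁ hW₁ hDb₁ w rfl hdead Q₁₂ Q₂₂ hW₂ Db₂ Y₁ Y₂ hX hXbar hW'₁ hW'₂ hC₁ h𝔔₀ h𝔔₁ h𝔔₂ hH'₁ h𝔔'₁
    -- `k2` BY TERM: an2's `torus_k2_sim_letter` at the weight `w := −2c` (`X = (w∕2) • E_λ`) with `L :=` the Λ half of `H₁`; the free `G` rides with unit slope
    (by
      rw [← torus_k2_sim_letter M' hN hW ((-2 : ℝ) * (((Lc : ℝ) ^ (d + 1) * stepScale d Lc 0)⁻¹)) h lam hH₀'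
        (∑ b : ↥(pbox (fine Lc M')) × Fin (d + 1), h b •
          (w • (perF (fine Lc M') (dper (fine Lc M')
            (SLam Lc (lamCoeffOf (KInv (N := Lc) (d := d)) Lc) (symHessFFAt (ctr (d + 1) Lc) Lc) b.2 (b.1 : Site (d + 1))))).submatrix
          (fun b : ↥(pbox (fine Lc M')) × Fin (d + 1) => ((b.1, Sum.inl b.2) : Idx (fine Lc M') (Fib d)))
          (fun b : ↥(pbox (fine Lc M')) × Fin (d + 1) => ((b.1, Sum.inl b.2) : Idx (fine Lc M') (Fib d)))))
        (X := X) (by rw [hX, show (-2 : ℝ) * (((Lc : ℝ) ^ (d + 1) * stepScale d Lc 0)⁻¹) / 2 = -(((Lc : ℝ) ^ (d + 1) * stepScale d Lc 0)⁻¹) by ring, neg_smul])]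
      abel)
    q2 t2
    -- `hH₂t` BY TERM: an2's `torus_H2_transpose` for the Wilson bi-member, the displayed `hGt` for `G`
    (by rw [Matrix.transpose_add, Matrix.transpose_smul, torus_H2_transpose (fine Lc M') hW h h, hGt])
    a1 a2 c2 d2 hΓ hI hL hS hB

end Summit.QuantumFields.BalabanUV.Beta.FP.NestedStepLawTorusTransportedRowsGradedLevelZeroSymULowClosedLamW2

end
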